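import Summits.QuantumFields.BalabanUV.T4Continuum.Spine.NE2.TorusBlockAveragePlaquette

/-!
# T⁴ programme, spine node NE2 (U1a) — BAŁABAN's BLOCK AVERAGE (42) OF A CONSTANT BOND CONFIGURATION (cell `pub-balaban-gaps`, seat ne2 gen 8)

Supplier file for the NON-FLAT non-vacuity witness of the coherent-tower END (`ComposedRemainderCoherentTowerSizes.…_of_coherentTowers_top`): for a
CONSTANT bond configuration `V ≡ g` (the same group element on every bond — a «constant connection»: zero curvature, non-trivial holonomy along
the cycles of the torus, non-trivial adjoint transport when `g` is not central)
 * §1 every parallel transport (9) is a power of `g`: `hol (fun _ _ => g) x w = g ^ znet w`, `znet w` = (number of forward letters) − (number of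
   backward letters) (`znet_append`, `znet_revWord`, `znet_seg`, `znet_gammaWord = L`);
 * §2 hence [B7] (42)'s loop variables are trivial, `V(Γ_{c,x})V(c)⁻¹ = 1` (`Wcx_const`), the exponent `X_c = 0` (`Xavg_const`), and **the average (42) of
   the constant configuration `g` is the constant configuration `g ^ L`** (`bavg_const`; on the torus carriers `bavgTor_const`) — the average of a
   constant connection at spacing `η` is the same connection read at spacing `Lη`;
 * §3 its plaquette holonomies are trivial (`tplaq_const`).
HONEST FRAMING (T4-DAG p. 1).  Elementary group bookkeeping about the tree's typed average; `g` is DATA; nothing of Bałaban's asserted beyond print; NOT NE2;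
**NE2 (U1a) NOT PROVED**; spine PROVED 0/9 unchanged; NOT continuum YM / infinite volume / mass gap / Clay.  No `sorry`.
-/

noncomputable section

open scoped BigOperators

namespace Summit.QuantumFields.BalabanUV.T4Continuum.NE2.TorusBlockAverageConstant

open Literature.MathematicalPhysics.QuantumFieldTheory.Balaban1983to89
open Literature.MathematicalPhysics.QuantumFieldTheory.Balaban1983to89.B7Prop1Explicit
  (Site Letter e hol stepHol seg gammaWord treeWord revWord Wcx Xavg bavg expUnit hol_cons hol_nil hol_append revWord_cons revWord_append seg_natCast)
open Literature.MathematicalPhysics.QuantumFieldTheory.Balaban1983to89.B5Prop11Plancherel (Tor fine unitVec)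
open Summit.QuantumFields.BalabanUV.T4Continuum.NE2.TorusBlockAveragePlaquette (liftCfg bavgTor tplaq)

variable {d : ℕ}

/-! ## §1 Transports of a constant configuration are powers -/

section Transport

/-- the NET LETTER COUNT of a lattice word: `+1` for every forward letter, `−1` for every backward one. [folklore] -/
def znet (w : List (Letter d)) : ℤ := (w.map fun l => if l.2 then (1 : ℤ) else -1).sum

/-- `znet [] = 0`. [folklore] -/
@[simp] theorem znet_nil : znet ([] : List (Letter d)) = 0 := rfl

/-- `znet (l :: w)`. [folklore] -/
@[simp] theorem znet_cons (l : Letter d) (w : List (Letter d)) : znet (l :: w) = (if l.2 then (1 : ℤ) else -1) + znet w := by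
  simp [znet]

/-- `znet` is additive under concatenation. [folklore] -/
@[simp] theorem znet_append (w₁ w₂ : List (Letter d)) : znet (w₁ ++ w₂) = znet w₁ + znet w₂ := by
  simp [znet, List.sum_append]

/-- reversing a word negates its net count. [folklore] -/
@[simp] theorem znet_revWord (w : List (Letter d)) : znet (revWord w) = -znet w := by
  induction w with
  | nil => simp
  | cons l w ih =>
      rw [revWord_cons, znet_append, ih, znet_cons, znet_cons, znet_nil, add_zero]
      obtain ⟨μ, b⟩ := l
      cases b <;> simp [Letter.rev]

/-- the straight segment of `n` forward steps has net count `n`. [folklore] -/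
@[simp] theorem znet_seg (κ : Fin d) (n : ℕ) : znet (seg κ (n : ℤ)) = n := by
  rw [seg_natCast]
  induction n with
  | zero => simp [znet]
  | succ n ih => rw [List.replicate_succ, znet_cons, ih]; simp; ring

/-- [B7] (14)'s contour `Γ_{c,x}` has net count `L` (the tree part and its reverse cancel). [cite: Balaban1985Averaging, (14) p.19 (shape)] [folklore] -/
theorem znet_gammaWord (L : ℕ) (κ : Fin d) (r : Site d) : znet (gammaWord L κ r) = L := by
  rw [gammaWord, znet_append, znet_append, znet_revWord, znet_seg]; ring

variable {G : Type*} [Group G] (g : G)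

/-- **EVERY TRANSPORT OF THE CONSTANT CONFIGURATION `V ≡ g` IS A POWER OF `g`**: `V(Γ) = g ^ znet Γ`. [cite: Balaban1985Averaging, (9) p.18 (shape)] [folklore] -/
theorem hol_const : ∀ (x : Site d) (w : List (Letter d)), hol (fun (_ : Site d) (_ : Fin d) => g) x w = g ^ znet w
  | x, [] => by rw [hol_nil, znet_nil, zpow_zero]
  | x, l :: w => by
      rw [hol_cons, hol_const (x + l.vec) w, znet_cons, zpow_add]
      congr 1
      unfold stepHol
      split_ifs <;> simp

/-- in particular the straight contour `Γ_c` of an `L`-bond transports by `g ^ L`. [folklore] -/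
theorem hol_const_seg (x : Site d) (κ : Fin d) (L : ℕ) : hol (fun (_ : Site d) (_ : Fin d) => g) x (seg κ (L : ℤ)) = g ^ L := by
  rw [hol_const, znet_seg, zpow_natCast]

end Transport

/-! ## §2 The average (42) of a constant configuration -/

section Average

variable {𝔸 : Type*} [NormedRing 𝔸] [NormOneClass 𝔸] [NormedAlgebra ℂ 𝔸] [CompleteSpace 𝔸] (L : ℕ) (g : 𝔸ˣ)

omit [NormOneClass 𝔸] [NormedAlgebra ℂ 𝔸] [CompleteSpace 𝔸] in
/-- **(42)'s LOOP VARIABLES OF A CONSTANT CONFIGURATION ARE TRIVIAL**: `V(Γ_{c,x})V(c)⁻¹ = g^L·(g^L)⁻¹ = 1`. [cite: Balaban1985Averaging, (42) p.23 (shape)] [folklore] -/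
theorem Wcx_const (q : Site d) (κ : Fin d) (r : Site d) : Wcx L (fun (_ : Site d) (_ : Fin d) => g) q κ r = 1 := by
  unfold Wcx
  rw [hol_const, hol_const, znet_gammaWord, znet_seg, mul_inv_cancel]

omit [NormOneClass 𝔸] [CompleteSpace 𝔸] in
/-- hence the exponent `X_c` of (42) vanishes. [cite: Balaban1985Averaging, (42) p.23 (shape)] [folklore] -/
theorem Xavg_const (q : Site d) (κ : Fin d) : Xavg L (fun (_ : Site d) (_ : Fin d) => g) q κ = 0 := by
  unfold Xavg
  simp only [Wcx_const, Units.val_one, MatrixLog.mlog_one, smul_zero, Finset.sum_const_zero]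

omit [NormOneClass 𝔸] in
/-- **THE AVERAGE (42) OF THE CONSTANT CONFIGURATION `g` IS THE CONSTANT CONFIGURATION `g ^ L`** (a constant connection at spacing `η` averages to itself read at
spacing `Lη`). [cite: Balaban1985Averaging, (42) p.23 (shape)] [folklore] -/
theorem bavg_const : bavg L (fun (_ : Site d) (_ : Fin d) => g) = fun _ _ => g ^ L := by
  funext q κ
  unfold bavg
  rw [Xavg_const, hol_const_seg]
  have h1 : expUnit (0 : 𝔸) = 1 := by
    ext
    show NormedSpace.exp (0 : 𝔸) = 1
    exact NormedSpace.exp_zero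
  rw [h1, one_mul]

variable (N : ℕ) [NeZero N] [NeZero L] (M : Fin d → ℕ) [hM : ∀ μ, NeZero (M μ)]

omit [NormOneClass 𝔸] [NeZero N] [NeZero L] hM in
/-- **ON THE TORUS CARRIERS**: the torus block average of the constant configuration `g` on `Tor (fine (L·N) M)` is the constant configuration `g ^ L` on
`Tor (fine N M)`. [cite: Balaban1985Averaging, (15) p.19, (42) p.23 (shape)] [folklore] -/
theorem bavgTor_const : bavgTor N L M (fun (_ : Tor (fine (L * N) M)) (_ : Fin d) => g) = fun _ _ => g ^ L := by
  funext y κ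
  show bavg L (liftCfg (P := fine (L * N) M) (fun (_ : Tor (fine (L * N) M)) (_ : Fin d) => g)) _ κ = g ^ L
  have hl : liftCfg (P := fine (L * N) M) (fun (_ : Tor (fine (L * N) M)) (_ : Fin d) => g) = fun (_ : Site d) (_ : Fin d) => g := rfl
  rw [hl, bavg_const]

end Average

/-! ## §3 Plaquettes of a constant configuration -/

section Plaquette

variable {G : Type*} [Group G] {Q : Fin d → ℕ}

/-- **A CONSTANT CONFIGURATION HAS TRIVIAL PLAQUETTE HOLONOMIES** (zero curvature): `g·g·g⁻¹·g⁻¹ = 1`. [cite: Balaban1985Averaging, (44) p.24 (shape)] [folklore] -/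
theorem tplaq_const (g : G) (y : Tor Q) (μ ν : Fin d) : tplaq (fun (_ : Tor Q) (_ : Fin d) => g) y μ ν = 1 := by
  unfold tplaq
  rw [mul_inv_cancel_right, mul_inv_cancel]

end Plaquette

end Summit.QuantumFields.BalabanUV.T4Continuum.NE2.TorusBlockAverageConstant

end
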